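import Summits.SmoothPoincare4.SmoothPoincare4.Theorems.ContractibleTwistedDoubleStandard.Negative.SphereAcyclicBisection

/-!
# `AcyclicBisectionRigidity` — negative-side support: transport and the characterisation form

Support lemmas for the crux
`Summit.SmoothPoincare4.SmoothPoincare4.Theses.ConvexBisection.AcyclicBisectionRigidity`
(stmt-SmoothPoincare4-10507), from the standing disprover's work file
`Cruxes/AcyclicBisectionRigidity/Disproof.lean` §11 (every statement inline):

* `acyclicBisection_transport` — the ∃-hypothesis of the crux ("`M` carries an acyclic
  common-contact Stein bisection") is transported along any diffeomorphism `M ≅ N` (post-compose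
  the two embeddings; tree lemma `Manifold.IsSmoothEmbedding.diffeomorph_comp`; the pushed-forward
  complex tangencies are both moved by the same differential, `map_mfderiv_diffeomorph_comp`);
* `acyclicBisection_of_diffeomorph_sphere` — hence EVERY `M ≅ S⁴` satisfies the hypothesis
  (transport of the hemisphere bisection `acyclicBisection_sphere`, p70210): the converse of the
  crux's implication is a theorem;
* `crux_iff_characterisation` — so the crux is EQUIVALENT to: among homotopy 4-spheres, carrying an
  acyclic common-contact Stein bisection CHARACTERISES the standard `S⁴`; counterexamples, if any,
  are whole diffeomorphism classes of exotic 4-spheres.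
-/

noncomputable section

-- The namespace is prescribed by the crux protocol (`Summit.<P>.<Sub>.Theorems.<Crux>.Negative`
-- with `P = Sub = SmoothPoincare4`), hence the duplicated component.
set_option linter.dupNamespace false

open scoped Manifold ContDiff Topology ContinuousMap
open Set Function Literature.Geometry.Symplectic Literature.AlgebraicTopology.SingularHomology
  CategoryTheory.Limits

namespace Summit.SmoothPoincare4.SmoothPoincare4.Theorems.AcyclicBisectionRigidity.Negative

open Summit.SmoothPoincare4.SmoothPoincare4.Theses.ConvexBisection
open Summit.SmoothPoincare4.SmoothPoincare4.Theorems.ContractibleTwistedDoubleStandard.Negative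
  (acyclicBisection_sphere)

/-- **Chain rule for pushed-forward subspaces**: pushing `S` forward by `d(Ψ ∘ e)` is pushing it
by `de` and then by `dΨ` (`e` smooth on a manifold with boundary, `Ψ` a diffeomorphism of the
target). [folklore] -/
theorem map_mfderiv_diffeomorph_comp {M N : Type} [TopologicalSpace M]
    [ChartedSpace (EuclideanSpace ℝ (Fin 4)) M] [IsManifold (𝓡 4) ∞ M] [TopologicalSpace N]
    [ChartedSpace (EuclideanSpace ℝ (Fin 4)) N] [IsManifold (𝓡 4) ∞ N]
    {W : Type} [TopologicalSpace W] [ChartedSpace (EuclideanHalfSpace 4) W] [IsManifold (𝓡∂ 4) ∞ W]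
    (Ψ : M ≃ₘ⟮𝓡 4, 𝓡 4⟯ N) {e : W → M} (he : ContMDiff (𝓡∂ 4) (𝓡 4) ∞ e) (w : W)
    (S : Submodule ℝ (EuclideanSpace ℝ (Fin 4))) :
    Submodule.map (mfderiv (𝓡∂ 4) (𝓡 4) (Ψ ∘ e) w).toLinearMap S =
      Submodule.map (mfderiv (𝓡 4) (𝓡 4) Ψ (e w)).toLinearMap
        (Submodule.map (mfderiv (𝓡∂ 4) (𝓡 4) e w).toLinearMap S) := by
  have hΨ : MDifferentiableAt (𝓡 4) (𝓡 4) Ψ (e w) := Ψ.mdifferentiable (by simp) (e w)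
  have he' : MDifferentiableAt (𝓡∂ 4) (𝓡 4) e w := he.mdifferentiableAt (by simp)
  rw [← Submodule.map_comp, mfderiv_comp w hΨ he']
  rfl

/-- **Transport of acyclic common-contact Stein bisections along diffeomorphisms.** If `M` is
covered by two smoothly embedded compact Stein domains meeting exactly along the images of their
boundaries with matching pushed-forward complex tangencies and ℚ-acyclic halves, then so is every
`N ≅ M` (post-compose both embeddings with the diffeomorphism). [folklore] -/
theorem acyclicBisection_transport {M N : Type} [TopologicalSpace M]
    [ChartedSpace (EuclideanSpace ℝ (Fin 4)) M] [IsManifold (𝓡 4) ∞ M] [TopologicalSpace N]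
    [ChartedSpace (EuclideanSpace ℝ (Fin 4)) N] [IsManifold (𝓡 4) ∞ N] (Ψ : M ≃ₘ⟮𝓡 4, 𝓡 4⟯ N)
    (h : ∃ (W₁ : Type) (_ : TopologicalSpace W₁) (_ : ChartedSpace (EuclideanHalfSpace 4) W₁)
        (_ : IsManifold (𝓡∂ 4) ∞ W₁) (_ : CompactSpace W₁) (W₂ : Type) (_ : TopologicalSpace W₂)
        (_ : ChartedSpace (EuclideanHalfSpace 4) W₂) (_ : IsManifold (𝓡∂ 4) ∞ W₂) (_ : CompactSpace W₂)
        (J₁ : SteinStructure W₁) (J₂ : SteinStructure W₂) (e₁ : W₁ → M) (e₂ : W₂ → M),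
        Manifold.IsSmoothEmbedding (𝓡∂ 4) (𝓡 4) ∞ e₁ ∧ Manifold.IsSmoothEmbedding (𝓡∂ 4) (𝓡 4) ∞ e₂ ∧
        Set.range e₁ ∪ Set.range e₂ = Set.univ ∧
        Set.range e₁ ∩ Set.range e₂ = e₁ '' (𝓡∂ 4).boundary W₁ ∧
        Set.range e₁ ∩ Set.range e₂ = e₂ '' (𝓡∂ 4).boundary W₂ ∧
        (∀ w₁ w₂, e₁ w₁ = e₂ w₂ →
          Submodule.map (mfderiv (𝓡∂ 4) (𝓡 4) e₁ w₁).toLinearMap (contactPlane J₁.J w₁) =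
          Submodule.map (mfderiv (𝓡∂ 4) (𝓡 4) e₂ w₂).toLinearMap (contactPlane J₂.J w₂)) ∧
        (∀ k, 0 < k → IsZero (singularHomology ℚ ℚ W₁ k) ∧ IsZero (singularHomology ℚ ℚ W₂ k))) :
    ∃ (W₁ : Type) (_ : TopologicalSpace W₁) (_ : ChartedSpace (EuclideanHalfSpace 4) W₁)
      (_ : IsManifold (𝓡∂ 4) ∞ W₁) (_ : CompactSpace W₁) (W₂ : Type) (_ : TopologicalSpace W₂)
      (_ : ChartedSpace (EuclideanHalfSpace 4) W₂) (_ : IsManifold (𝓡∂ 4) ∞ W₂) (_ : CompactSpace W₂)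
      (J₁ : SteinStructure W₁) (J₂ : SteinStructure W₂) (e₁ : W₁ → N) (e₂ : W₂ → N),
      Manifold.IsSmoothEmbedding (𝓡∂ 4) (𝓡 4) ∞ e₁ ∧ Manifold.IsSmoothEmbedding (𝓡∂ 4) (𝓡 4) ∞ e₂ ∧
      Set.range e₁ ∪ Set.range e₂ = Set.univ ∧
      Set.range e₁ ∩ Set.range e₂ = e₁ '' (𝓡∂ 4).boundary W₁ ∧
      Set.range e₁ ∩ Set.range e₂ = e₂ '' (𝓡∂ 4).boundary W₂ ∧
      (∀ w₁ w₂, e₁ w₁ = e₂ w₂ →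
        Submodule.map (mfderiv (𝓡∂ 4) (𝓡 4) e₁ w₁).toLinearMap (contactPlane J₁.J w₁) =
        Submodule.map (mfderiv (𝓡∂ 4) (𝓡 4) e₂ w₂).toLinearMap (contactPlane J₂.J w₂)) ∧
      (∀ k, 0 < k → IsZero (singularHomology ℚ ℚ W₁ k) ∧ IsZero (singularHomology ℚ ℚ W₂ k)) := by
  obtain ⟨W₁, _, _, _, _, W₂, _, _, _, _, J₁, J₂, e₁, e₂, he₁, he₂, hcover, hseam₁, hseam₂, hξ, hac⟩ := h
  have hinj : Injective Ψ := Ψ.injective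
  have hsurj : Surjective Ψ := Ψ.surjective
  refine ⟨W₁, _, _, _, _, W₂, _, _, _, _, J₁, J₂, Ψ ∘ e₁, Ψ ∘ e₂, he₁.diffeomorph_comp Ψ,
    he₂.diffeomorph_comp Ψ, ?_, ?_, ?_, ?_, hac⟩
  · rw [range_comp, range_comp, ← image_union, hcover, image_univ, hsurj.range_eq]
  · rw [range_comp, range_comp, ← image_inter hinj, hseam₁, image_comp]
  · rw [range_comp, range_comp, ← image_inter hinj, hseam₂, image_comp]
  · intro w₁ w₂ hw
    have hw' : e₁ w₁ = e₂ w₂ := hinj hw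
    rw [map_mfderiv_diffeomorph_comp Ψ he₁.contMDiff, map_mfderiv_diffeomorph_comp Ψ he₂.contMDiff,
      hξ w₁ w₂ hw', hw']

/-- **Every standard 4-sphere carries an acyclic common-contact Stein bisection**: if `M ≅ S⁴`
then the ∃-hypothesis of the crux holds at `M` (transport of the hemisphere bisection of the
round sphere, `acyclicBisection_sphere`). So the CONVERSE of `AcyclicBisectionRigidity`'s
implication is a theorem, and no counterexample search may use an `M` known to be standard.
[folklore] -/
theorem acyclicBisection_of_diffeomorph_sphere {M : Type} [TopologicalSpace M]
    [ChartedSpace (EuclideanSpace ℝ (Fin 4)) M] [IsManifold (𝓡 4) ∞ M]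
    (Ψ : M ≃ₘ⟮𝓡 4, 𝓡 4⟯ Metric.sphere (0 : EuclideanSpace ℝ (Fin 5)) 1) :
    ∃ (W₁ : Type) (_ : TopologicalSpace W₁) (_ : ChartedSpace (EuclideanHalfSpace 4) W₁)
      (_ : IsManifold (𝓡∂ 4) ∞ W₁) (_ : CompactSpace W₁) (W₂ : Type) (_ : TopologicalSpace W₂)
      (_ : ChartedSpace (EuclideanHalfSpace 4) W₂) (_ : IsManifold (𝓡∂ 4) ∞ W₂) (_ : CompactSpace W₂)
      (J₁ : SteinStructure W₁) (J₂ : SteinStructure W₂) (e₁ : W₁ → M) (e₂ : W₂ → M),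
      Manifold.IsSmoothEmbedding (𝓡∂ 4) (𝓡 4) ∞ e₁ ∧ Manifold.IsSmoothEmbedding (𝓡∂ 4) (𝓡 4) ∞ e₂ ∧
      Set.range e₁ ∪ Set.range e₂ = Set.univ ∧
      Set.range e₁ ∩ Set.range e₂ = e₁ '' (𝓡∂ 4).boundary W₁ ∧
      Set.range e₁ ∩ Set.range e₂ = e₂ '' (𝓡∂ 4).boundary W₂ ∧
      (∀ w₁ w₂, e₁ w₁ = e₂ w₂ →
        Submodule.map (mfderiv (𝓡∂ 4) (𝓡 4) e₁ w₁).toLinearMap (contactPlane J₁.J w₁) =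
        Submodule.map (mfderiv (𝓡∂ 4) (𝓡 4) e₂ w₂).toLinearMap (contactPlane J₂.J w₂)) ∧
      (∀ k, 0 < k → IsZero (singularHomology ℚ ℚ W₁ k) ∧ IsZero (singularHomology ℚ ℚ W₂ k)) :=
  acyclicBisection_transport Ψ.symm acyclicBisection_sphere

/-- **Characterisation form of the crux.** `AcyclicBisectionRigidity` is EQUIVALENT to: for every
homotopy 4-sphere `M`, "`M` carries an acyclic common-contact Stein bisection" ⟺ "`M` is
diffeomorphic to `S⁴`" (the inner `←` being `acyclicBisection_of_diffeomorph_sphere`). The crux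
is thus a recognition theorem for `S⁴` by a diffeomorphism-invariant structure; its failure is a
diffeomorphism class of acyclically Stein-bisectable exotic 4-spheres. [folklore] -/
theorem crux_iff_characterisation : AcyclicBisectionRigidity ↔
    ∀ (M : Type) [TopologicalSpace M] [T2Space M] [SecondCountableTopology M]
      [ChartedSpace (EuclideanSpace ℝ (Fin 4)) M] [IsManifold (𝓡 4) ∞ M],
      M ≃ₕ Metric.sphere (0 : EuclideanSpace ℝ (Fin 5)) 1 →
      ((∃ (W₁ : Type) (_ : TopologicalSpace W₁) (_ : ChartedSpace (EuclideanHalfSpace 4) W₁)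
        (_ : IsManifold (𝓡∂ 4) ∞ W₁) (_ : CompactSpace W₁) (W₂ : Type) (_ : TopologicalSpace W₂)
        (_ : ChartedSpace (EuclideanHalfSpace 4) W₂) (_ : IsManifold (𝓡∂ 4) ∞ W₂) (_ : CompactSpace W₂)
        (J₁ : SteinStructure W₁) (J₂ : SteinStructure W₂) (e₁ : W₁ → M) (e₂ : W₂ → M),
        Manifold.IsSmoothEmbedding (𝓡∂ 4) (𝓡 4) ∞ e₁ ∧ Manifold.IsSmoothEmbedding (𝓡∂ 4) (𝓡 4) ∞ e₂ ∧
        Set.range e₁ ∪ Set.range e₂ = Set.univ ∧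
        Set.range e₁ ∩ Set.range e₂ = e₁ '' (𝓡∂ 4).boundary W₁ ∧
        Set.range e₁ ∩ Set.range e₂ = e₂ '' (𝓡∂ 4).boundary W₂ ∧
        (∀ w₁ w₂, e₁ w₁ = e₂ w₂ →
          Submodule.map (mfderiv (𝓡∂ 4) (𝓡 4) e₁ w₁).toLinearMap (contactPlane J₁.J w₁) =
          Submodule.map (mfderiv (𝓡∂ 4) (𝓡 4) e₂ w₂).toLinearMap (contactPlane J₂.J w₂)) ∧
        (∀ k, 0 < k → IsZero (singularHomology ℚ ℚ W₁ k) ∧ IsZero (singularHomology ℚ ℚ W₂ k))) ↔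
      Nonempty (M ≃ₘ⟮𝓡 4, 𝓡 4⟯ Metric.sphere (0 : EuclideanSpace ℝ (Fin 5)) 1)) :=
  ⟨fun h M _ _ _ _ _ e => ⟨h M e, fun ⟨Ψ⟩ => acyclicBisection_of_diffeomorph_sphere Ψ⟩,
    fun h M _ _ _ _ _ e hb => (h M e).1 hb⟩

end Summit.SmoothPoincare4.SmoothPoincare4.Theorems.AcyclicBisectionRigidity.Negative
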